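import Mathlib
import Literature.AlgebraicGeometry.Resolution.RegularLocalRingsProofs
import Summits.ResolutionOfSingularities.ResolutionOfSingularities.Theorems.WeightedInvariantEssSmoothLocalHomOrder
import HarnessLib

/-!
# A formally smooth, essentially finite type field extension acquires no new `p`-th roots ((o24-C) core)

Topic: `Summits/ResolutionOfSingularities/ResolutionOfSingularities/Theorems`. Helper for the door item
`HypersurfaceCentreConstruction` (statement `stmt-ResolutionOfSingularities-19897`, route `WeightedInvariant`),
line `local-engine` of `res-L1-w43-plan-1` (L W4.3), ORDER (o24) rung P2, piece **(o24-C)** «(c11)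
`IotaJEssSmoothCompatibleLE2 iotaOrd jContact`» (hand res-type-078): the FIELD-THEORETIC CORE.  Along an essentially
smooth local homomorphism of two-dimensional regular local rings the residue field extension `κ → κ'` is formally smooth
and essentially of finite type; the maximality of the contact level (`…ContactFiltrationTerminal`, p513413) pulls back
along such a map exactly because `κ'` contains no NEW `p`-th roots of elements of `κ` (case D with `p ∣ ν`: a face
`c (s^{p^e} + θ)^{m'}` over `κ` becomes the `ν`-th power of a linear form over `κ'` iff `θ` becomes a `p^e`-th power).

[OURS · L1 W4.3] Replaces the role of NO printed item; NOT a statement of the manuscript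
[claim: Hironaka2017, status: under-review]. AI work, weaker than expert review.

## Statement and proof

`exists_pow_eq_of_formallySmooth`: `κ → K` formally smooth and essentially of finite type (fields of characteristic `p`),
`λ ∈ K` with `λ^p = θ ∈ κ` ⇒ `θ = μ^p` for some `μ ∈ κ`; `exists_pow_pow_eq_of_formallySmooth`: the same for `p^e`.
Proof: otherwise `X^p - θ` is irreducible over `κ` (Mathlib `X_pow_sub_C_irreducible_of_prime`), `L = κ[u]/(u^p - θ)` is a
field, and `L ⊗_κ K` is a LOCAL ring (every element has its `p`-th power in `K`: nilpotent or unit), formally smooth and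
essentially of finite type over `L` (base change), hence REGULAR (tree `isRegularLocalRing_fiber`, p507256, applied to
`L → L ⊗_κ K` whose closed fibre is the ring itself), hence a domain — but `u ⊗ 1 - 1 ⊗ λ` is a non-zero nilpotent
(`(u ⊗ 1 - 1 ⊗ λ)^p = θ - θ = 0`; non-zero since `1, u, …, u^{p-1}` stay `K`-independent in `K ⊗_κ L`).

## References

* H. Matsumura, *Commutative Ring Theory*, Thm. 26.9 and §28 (formally smooth field extensions are separable).
  [Matsumura1987]
* A. Grothendieck, EGA 0_IV 19.6.1 (formal smoothness and separability). [folklore]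
-/

noncomputable section

open IsLocalRing Polynomial TensorProduct

set_option linter.dupNamespace false -- mandated namespace of this single-conjunct summit

namespace Summit.ResolutionOfSingularities.ResolutionOfSingularities.Theorems

namespace FormallySmoothField

open Summit.ResolutionOfSingularities.ResolutionOfSingularities.Cruxes.HypersurfaceCentreConstruction.LocalEngine
  (isRegularLocalRing_fiber)
open Literature.AlgebraicGeometry.Resolution (isDomain_of_isRegularLocalRing)

/-- In `L = κ[u]/(u^p - θ)` (characteristic `p`) every element has its `p`-th power in `κ`. [folklore] -/
theorem exists_pow_eq_algebraMap_of_adjoinRoot (κ : Type) [Field κ] (p : ℕ) [Fact p.Prime] [CharP κ p] (θ : κ)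
    (l : AdjoinRoot (X ^ p - C θ)) : ∃ c : κ, l ^ p = algebraMap κ (AdjoinRoot (X ^ p - C θ)) c := by
  haveI : ExpChar κ p := ExpChar.prime Fact.out
  induction l using AdjoinRoot.induction_on with
  | ih q =>
    refine ⟨eval θ (q.map (frobenius κ p)), ?_⟩
    have hroot : (AdjoinRoot.root (X ^ p - C θ)) ^ p = algebraMap κ _ θ := by
      have h := AdjoinRoot.eval₂_root (X ^ p - C θ)
      rw [eval₂_sub, eval₂_X_pow, eval₂_C, sub_eq_zero] at h
      rw [h]
      rfl
    have e1 : (AdjoinRoot.mk (X ^ p - C θ) q) ^ p = AdjoinRoot.mk (X ^ p - C θ) (q ^ p) := (map_pow _ _ _).symm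
    have e2 : q ^ p = expand κ p (q.map (frobenius κ p)) := by
      rw [← Polynomial.map_expand, map_frobenius_expand]
    rw [e1, e2, ← AdjoinRoot.aeval_eq, Polynomial.expand_aeval, hroot,
      Polynomial.aeval_algebraMap_apply_eq_algebraMap_eval]

/-- **No new `p`-th roots along a formally smooth, essentially finite type field extension.** [cite: Matsumura1987, Thm. 26.9] -/
theorem exists_pow_eq_of_formallySmooth (κ K : Type) [Field κ] [Field K] [Algebra κ K] [Algebra.FormallySmooth κ K]
    [Algebra.EssFiniteType κ K] (p : ℕ) [Fact p.Prime] [CharP κ p] {θ : κ} {lam : K}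
    (hlam : lam ^ p = algebraMap κ K θ) : ∃ μ : κ, μ ^ p = θ := by
  classical
  have hp : p.Prime := Fact.out
  by_contra hne
  push Not at hne
  -- `L = κ[u]/(u^p - θ)` is a field
  have hirr : Irreducible (X ^ p - C θ : κ[X]) := X_pow_sub_C_irreducible_of_prime hp (fun b hb => hne b hb)
  haveI := Fact.mk hirr
  set f : κ[X] := X ^ p - C θ with hf
  have hf0 : f ≠ 0 := hirr.ne_zero
  let L := AdjoinRoot f
  letI : Field L := AdjoinRoot.instField
  let u : L := AdjoinRoot.root f
  have hu : u ^ p = algebraMap κ L θ := by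
    have h := AdjoinRoot.eval₂_root f
    rw [hf, eval₂_sub, eval₂_X_pow, eval₂_C, sub_eq_zero] at h
    rw [h]
    rfl
  -- the ring `T = L ⊗_κ K`
  haveI hKchar : CharP K p := charP_of_injective_algebraMap (algebraMap κ K).injective p
  haveI : Nontrivial (L ⊗[κ] K) := inferInstance
  haveI : CharP (L ⊗[κ] K) p := charP_of_injective_algebraMap (algebraMap κ (L ⊗[κ] K)).injective p
  -- every element of `T` has its `p`-th power in `K`
  have hpow : ∀ z : L ⊗[κ] K, ∃ k : K, z ^ p = (1 : L) ⊗ₜ[κ] k := by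
    intro z
    induction z using TensorProduct.induction_on with
    | zero => exact ⟨0, by rw [zero_pow hp.ne_zero, tmul_zero]⟩
    | tmul l k =>
      obtain ⟨c, hc⟩ := exists_pow_eq_algebraMap_of_adjoinRoot κ p θ l
      refine ⟨c • k ^ p, ?_⟩
      rw [Algebra.TensorProduct.tmul_pow, hc, Algebra.algebraMap_eq_smul_one, TensorProduct.smul_tmul, ]
    | add z₁ z₂ h₁ h₂ =>
      obtain ⟨k₁, hk₁⟩ := h₁
      obtain ⟨k₂, hk₂⟩ := h₂
      exact ⟨k₁ + k₂, by rw [add_pow_char, hk₁, hk₂, tmul_add]⟩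
  -- hence `T` is local
  haveI : IsLocalRing (L ⊗[κ] K) := by
    refine IsLocalRing.of_isUnit_or_isUnit_one_sub_self fun z => ?_
    obtain ⟨k, hk⟩ := hpow z
    by_cases hk0 : k = 0
    · right
      have hnil : IsNilpotent z := ⟨p, by rw [hk, hk0, tmul_zero]⟩
      exact hnil.isUnit_one_sub
    · left
      have : IsUnit (z ^ p) := by
        rw [hk]
        exact ((isUnit_iff_ne_zero.mpr hk0).map
          (Algebra.TensorProduct.includeRight : K →ₐ[κ] L ⊗[κ] K))
      exact (isUnit_pow_iff hp.ne_zero).mp this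
  haveI : IsLocalHom (algebraMap L (L ⊗[κ] K)) := by
    refine ⟨fun l hl => ?_⟩
    by_contra hlu
    have hl0 : l = 0 := by simpa [isUnit_iff_ne_zero] using hlu
    rw [hl0, map_zero] at hl
    exact not_isUnit_zero hl
  -- `T` is regular local (its closed fibre over `L` is itself), hence a domain
  have hreg := isRegularLocalRing_fiber L (L ⊗[κ] K)
  have hbot : (maximalIdeal L).map (algebraMap L (L ⊗[κ] K)) = ⊥ := by
    rw [(IsLocalRing.isField_iff_maximalIdeal_eq).mp (Field.toIsField L), Ideal.map_bot]
  haveI : IsDomain ((L ⊗[κ] K) ⧸ (maximalIdeal L).map (algebraMap L (L ⊗[κ] K))) :=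
    @isDomain_of_isRegularLocalRing _ _ hreg
  -- the non-zero nilpotent `w = u ⊗ 1 - 1 ⊗ λ`
  set w : L ⊗[κ] K := u ⊗ₜ[κ] (1 : K) - (1 : L) ⊗ₜ[κ] lam with hw
  have hwp : w ^ p = 0 := by
    rw [hw, sub_pow_char, Algebra.TensorProduct.tmul_pow, Algebra.TensorProduct.tmul_pow, one_pow, one_pow, hu,
      hlam, ← Algebra.TensorProduct.algebraMap_apply, ← Algebra.TensorProduct.algebraMap_apply', sub_self]
  have hw0 : w = 0 := by
    have : (Ideal.Quotient.mk ((maximalIdeal L).map (algebraMap L (L ⊗[κ] K))) w) ^ p = 0 := by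
      rw [← map_pow, hwp, map_zero]
    have h1 := pow_eq_zero_iff (n := p) hp.ne_zero |>.mp this
    rw [Ideal.Quotient.eq_zero_iff_mem, hbot, Ideal.mem_bot] at h1
    exact h1
  -- but `1 ⊗ u - λ ⊗ 1 ≠ 0` in `K ⊗_κ L` (the images `1 ⊗ u^i` form a `K`-basis)
  let pb := AdjoinRoot.powerBasis (K := κ) hf0
  have hdim : pb.dim = p := by
    rw [AdjoinRoot.powerBasis_dim, hf, natDegree_X_pow_sub_C]
  let B := Algebra.TensorProduct.basis K pb.basis
  have hB : ∀ i : Fin pb.dim, B i = (1 : K) ⊗ₜ[κ] (u ^ (i : ℕ)) := fun i => by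
    rw [Algebra.TensorProduct.basis_apply, PowerBasis.basis_eq_pow]
    rfl
  have h1 : 1 < pb.dim := by rw [hdim]; exact hp.one_lt
  have h0 : 0 < pb.dim := by omega
  have hw' : Algebra.TensorProduct.comm κ L K w = B ⟨1, h1⟩ - lam • B ⟨0, h0⟩ := by
    rw [hw, map_sub, Algebra.TensorProduct.comm_tmul, Algebra.TensorProduct.comm_tmul, hB, hB, pow_one, pow_zero,
      TensorProduct.smul_tmul', smul_eq_mul, mul_one]
  have hne01 : (⟨0, h0⟩ : Fin pb.dim) ≠ ⟨1, h1⟩ := by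
    intro h; have := congrArg Fin.val h; simp at this
  have hcoord : B.repr (Algebra.TensorProduct.comm κ L K w) ⟨1, h1⟩ = 1 := by
    rw [hw', map_sub, map_smul, B.repr_self, B.repr_self, Finsupp.sub_apply, Finsupp.smul_apply,
      Finsupp.single_eq_same, Finsupp.single_eq_of_ne hne01.symm, smul_zero, sub_zero]
  rw [hw0, map_zero, map_zero, Finsupp.zero_apply] at hcoord
  exact zero_ne_one hcoord

/-- The `p^e`-th power version: `λ^{p^e} = θ ∈ κ` with `λ ∈ K` forces `θ ∈ κ^{p^e}`. [cite: Matsumura1987, Thm. 26.9] -/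
theorem exists_pow_pow_eq_of_formallySmooth (κ K : Type) [Field κ] [Field K] [Algebra κ K]
    [Algebra.FormallySmooth κ K] [Algebra.EssFiniteType κ K] (p : ℕ) [Fact p.Prime] [CharP κ p] (e : ℕ)
    {θ : κ} {lam : K} (hlam : lam ^ p ^ e = algebraMap κ K θ) : ∃ μ : κ, μ ^ p ^ e = θ := by
  induction e generalizing θ lam with
  | zero =>
    refine ⟨θ, ?_⟩
    simp
  | succ e ih =>
    -- `(λ^{p^e})^p = θ`
    have h1 : (lam ^ p ^ e) ^ p = algebraMap κ K θ := by rw [← pow_mul, ← pow_succ, hlam]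
    obtain ⟨μ₁, hμ₁⟩ := exists_pow_eq_of_formallySmooth κ K p h1
    -- `λ^{p^e} = μ₁` (Frobenius is injective on the field `K`)
    haveI : CharP K p := charP_of_injective_algebraMap (algebraMap κ K).injective p
    have h2 : lam ^ p ^ e = algebraMap κ K μ₁ := by
      have : (lam ^ p ^ e - algebraMap κ K μ₁) ^ p = 0 := by
        rw [sub_pow_char, h1, ← map_pow, hμ₁, sub_self]
      exact sub_eq_zero.mp (pow_eq_zero_iff (Fact.out : p.Prime).ne_zero |>.mp this)
    obtain ⟨μ, hμ⟩ := ih h2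
    exact ⟨μ, by rw [pow_succ, pow_mul, hμ, hμ₁]⟩

end FormallySmoothField

end Summit.ResolutionOfSingularities.ResolutionOfSingularities.Theorems

end
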